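import Mathlib
import Literature.AlgebraicGeometry.Resolution.QuadraticTransformDelta
import HarnessLib

/-!
# The contact order of an ideal along the branches of a one-dimensional local domain

Topic: `Literature/AlgebraicGeometry/Resolution`. The numerical invariant that measures, in Krull's
blow-up tower of a one-dimensional reduced local ring (Kollár 2007, Alg. 1.100 / Thm. 1.101;
Krull 1930), how long two branches stay together: for a local domain `D ⊆ K` (`K` its fraction
field) and an ideal `J` of `D` (the image of the OTHER branch), the **branches** of `D` are the
valuation rings `W ≠ K` of `K` containing `D` (`branchValuationSet`; for `D` one-dimensional Noetherian with
finite normalization these are the discrete valuation rings `D̄_𝔑`), the **contact length**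
`branchLength W J = ℓ_W(W / J W)` and the **contact order** `contactOrder D K J = sup_W ℓ_W(W/JW)`.
PROVED:

* `branchLength_add_one_le` — in a Noetherian valuation ring `W`: if `J W ⊆ t · J₁ W` with `t` a
  non-unit and `J₁ W ≠ 0`, then `ℓ_W(W/J₁W) + 1 ≤ ℓ_W(W/JW)` (Nakayama);
* `mem_branchValuationSet_iff_exists` / `branchValuationSet_finite` / `branchValuationSet_nonempty` — for a one-dimensional
  Noetherian local domain with finite (Dedekind) normalization the branches are the `D̄_𝔑`;
* `contactOrder_add_one_le` — **separation of branches**: along a quadratic transform `D ⊆ D₁`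
  with `J D₁ ⊆ x · J₁` (`x` the exceptional parameter, `J₁ ≠ 0` the new image of the other branch)
  the contact order drops: `contactOrder D₁ K J₁ + 1 ≤ contactOrder D K J`;
* `one_le_contactOrder`, `contactOrder_ne_top` — positivity (for `J ⊆ 𝔪_D`) and finiteness
  (for `J ≠ 0`, Krull–Akizuki);
* invariance under field isomorphisms is in `BranchContactOrderTransport.lean`.

## Sources

* J. Kollár, *Lectures on Resolution of Singularities*, Ann. of Math. Stud. 166 (2007), §1.4,
  Alg. 1.100, Thm. 1.101. [Kollar2007]
-/

noncomputable section

open IsLocalRing IsDedekindDomain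

namespace Literature.AlgebraicGeometry.Resolution

universe u

variable {K : Type u} [Field K]

/-! ## Branch ideals and contact lengths in a valuation ring of `K` -/

section Length

variable (W : ValuationSubring K)

/-- The ideal `J W` of the valuation ring `W ⊆ K` generated by a subset `J ⊆ K` (the elements of
`W` lying in `J`). [cite: Kollar2007, §1.4] -/
def branchIdeal (J : Set K) : Ideal W :=
  Ideal.span {w : W | (w : K) ∈ J}

/-- **Contact length** `ℓ_W(W / J W)` of `J` along the branch `W`. [cite: Kollar2007, §1.4] -/
def branchLength (J : Set K) : ℕ∞ :=
  Module.length W (W ⧸ branchIdeal W J)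

variable {W}

/-- Generators of `J W`. [cite: Kollar2007, §1.4] -/
theorem mem_branchIdeal {J : Set K} {w : W} (hw : (w : K) ∈ J) : w ∈ branchIdeal W J :=
  Ideal.subset_span hw

/-- `J W ≠ 0` as soon as `J` contains a nonzero element of `W`. [cite: Kollar2007, §1.4] -/
theorem branchIdeal_ne_bot {J : Set K} {w : W} (hw : (w : K) ∈ J) (hw0 : w ≠ 0) :
    branchIdeal W J ≠ ⊥ := fun h =>
  hw0 (by have := mem_branchIdeal (W := W) hw; rw [h, Ideal.mem_bot] at this; exact this)

/-- `J W ⊆ t · J₁ W` when every element of `J` is `t` times an element of `J₁ ∩ W`.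
[cite: Kollar2007, §1.4] -/
theorem branchIdeal_le_span_mul {J J₁ : Set K} (t : W)
    (h : ∀ a ∈ J, ∃ y : W, (y : K) ∈ J₁ ∧ a = (t : K) * y) :
    branchIdeal W J ≤ Ideal.span {t} * branchIdeal W J₁ := by
  refine Ideal.span_le.mpr fun w hw => ?_
  obtain ⟨y, hy, hwy⟩ := h _ hw
  have : w = t * y := Subtype.ext (by rw [hwy]; rfl)
  rw [this]
  exact Ideal.mul_mem_mul (Ideal.mem_span_singleton_self t) (mem_branchIdeal hy)

/-- **The contact length drops by at least one**: in a Noetherian valuation ring `W`, if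
`J W ⊆ t · J₁ W` with `t ∈ 𝔪_W` and `J₁ W ≠ 0`, then `ℓ_W(W/J₁W) + 1 ≤ ℓ_W(W/JW)`
(`J₁W/tJ₁W ≠ 0` by Nakayama). [cite: Kollar2007, §1.4] -/
theorem branchLength_add_one_le [IsNoetherianRing W] {J J₁ : Set K} (t : W)
    (ht : t ∈ maximalIdeal W) (h : ∀ a ∈ J, ∃ y : W, (y : K) ∈ J₁ ∧ a = (t : K) * y)
    (h₁ : branchIdeal W J₁ ≠ ⊥) : branchLength W J₁ + 1 ≤ branchLength W J := by
  set I := branchIdeal W J with hI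
  set I₁ := branchIdeal W J₁ with hI₁
  have hle : I ≤ Ideal.span {t} * I₁ := branchIdeal_le_span_mul t h
  have hle' : Ideal.span {t} * I₁ ≤ I₁ := Ideal.mul_le_left
  -- `ℓ(W/(t I₁)) = ℓ(I₁/(t I₁)) + ℓ(W/I₁)` and `I₁/(t I₁) ≠ 0`
  have hadd := length_quotient_eq_add (A := W) (M := W) hle'
  have hpos : 1 ≤ Module.length W ↥(Submodule.map (Ideal.span {t} * I₁).mkQ I₁) := by
    rw [Order.one_le_iff_ne_zero, Ne, Module.length_eq_zero_iff, not_subsingleton_iff_nontrivial,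
      Submodule.nontrivial_iff_ne_bot]
    intro hbot
    apply h₁
    refine Submodule.eq_bot_of_le_smul_of_le_jacobson_bot (Ideal.span {t}) I₁
      (IsNoetherian.noetherian _) ?_ ?_
    · intro y hy
      have hy0 : (Ideal.span {t} * I₁).mkQ y = 0 := by
        have : (Ideal.span {t} * I₁).mkQ y ∈ Submodule.map (Ideal.span {t} * I₁).mkQ I₁ :=
          ⟨y, hy, rfl⟩
        rw [hbot] at this
        exact this
      rw [Submodule.mkQ_apply, Submodule.Quotient.mk_eq_zero] at hy0
      rw [Ideal.smul_eq_mul]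
      exact hy0
    · exact (Ideal.span_singleton_le_iff_mem _).mpr ht |>.trans (maximalIdeal_le_jacobson _)
  calc branchLength W J₁ + 1 = Module.length W (W ⧸ I₁) + 1 := rfl
    _ ≤ Module.length W (W ⧸ I₁) + Module.length W ↥(Submodule.map (Ideal.span {t} * I₁).mkQ I₁) :=
        add_le_add_right hpos _
    _ = Module.length W (W ⧸ (Ideal.span {t} * I₁)) := by rw [hadd, add_comm]
    _ ≤ Module.length W (W ⧸ I) :=
        Module.length_le_of_surjective (Submodule.factor hle) (Submodule.factor_surjective hle)

end Length

/-! ## Branches of a subring and the contact order -/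

section Order

/-- The **branches** of a subring `D ⊆ K`: the valuation rings `W ≠ K` of `K` containing `D`
(for a one-dimensional Noetherian local domain with finite normalization: the `D̄_𝔑`).
[cite: Kollar2007, §1.4] -/
def branchValuationSet (D : Subring K) : Set (ValuationSubring K) :=
  {W | W ≠ ⊤ ∧ D ≤ W.toSubring}

/-- The **contact order** of `J ⊆ K` along `D`: the maximum over the branches `W` of `D` of the
contact lengths `ℓ_W(W/JW)`. [cite: Kollar2007, §1.4] -/
def contactOrder (D : Subring K) (J : Set K) : ℕ∞ :=
  ⨆ W : branchValuationSet D, branchLength W.1 J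

variable {D D₁ : Subring K}

/-- Branches of an overring are branches. [cite: Kollar2007, §1.4] -/
theorem branchValuationSet_mono (h : D ≤ D₁) : branchValuationSet D₁ ⊆ branchValuationSet D :=
  fun _ hW => ⟨hW.1, h.trans hW.2⟩

/-- `ℓ_W(W/JW) ≤ contactOrder D J` for a branch `W` of `D`. [cite: Kollar2007, §1.4] -/
theorem branchLength_le_contactOrder {W : ValuationSubring K} (hW : W ∈ branchValuationSet D) (J : Set K) :
    branchLength W J ≤ contactOrder D J :=
  le_iSup (fun W : branchValuationSet D => branchLength W.1 J) ⟨W, hW⟩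

section Dedekind

variable [IsDedekindDomain (integralClosure D K)] [IsFractionRing (integralClosure D K) K]
  [IsFractionRing D K]

omit [IsFractionRing D K] in
/-- The valuation ring `D̄_𝔑` of a maximal ideal of the normalization is a branch.
[cite: Kollar2007, §1.4] -/
theorem valuationSubringAtPrime_mem_branchValuationSet (v : HeightOneSpectrum (integralClosure D K)) :
    v.valuationSubringAtPrime K ∈ branchValuationSet D := by
  refine ⟨fun htop => ?_, le_valuationSubringAtPrime v⟩
  -- a nonzero `a ∈ 𝔑` has `v(a) < 1`, so `a⁻¹ ∉ D̄_𝔑`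
  obtain ⟨a, ha, ha0⟩ := Submodule.exists_mem_ne_zero_of_ne_bot v.ne_bot
  have hva : v.valuation K (a : K) < 1 := (v.valuation_lt_one_iff_mem (K := K) a).mpr ha
  have ha0' : (a : K) ≠ 0 := fun e => ha0 (Subtype.ext e)
  have hmem : (a : K)⁻¹ ∈ v.valuationSubringAtPrime K := htop ▸ trivial
  rw [HeightOneSpectrum.valuationSubringAtPrime_eq_valuationSubring,
    Valuation.mem_valuationSubring_iff, map_inv₀,
    inv_le_one₀ (pos_iff_ne_zero.mpr ((map_ne_zero _).mpr ha0'))] at hmem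
  exact not_lt.mpr hmem hva

/-- **Every branch is a `D̄_𝔑`**: a valuation ring `W ≠ K` containing `D` contains the Dedekind
domain `D̄`, its centre `𝔑 = 𝔪_W ∩ D̄` is a nonzero prime, and `D̄_𝔑 ⊆ W` forces `W = D̄_𝔑`
(a discrete valuation ring is a maximal proper subring). [cite: Kollar2007, §1.4] -/
theorem exists_valuationSubringAtPrime_eq_of_mem_branchValuationSet {W : ValuationSubring K} (hW : W ∈ branchValuationSet D) :
    ∃ v : HeightOneSpectrum (integralClosure D K), v.valuationSubringAtPrime K = W := by
  classical
  -- `D̄ ⊆ W`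
  have hbar : ∀ a : integralClosure D K, (a : K) ∈ W := fun a =>
    integralClosure_le_valuationSubring (R := D) W (fun r => hW.2 r.2) a a.2
  let φ : integralClosure D K →+* W :=
    (algebraMap (integralClosure D K) K).codRestrict W.toSubring fun a => hbar a
  let 𝔑 : Ideal (integralClosure D K) := (maximalIdeal W).comap φ
  haveI h𝔑p : 𝔑.IsPrime := Ideal.comap_isPrime _ _
  -- units of `W` coming from `D̄ ∖ 𝔑` have their inverses in `W`
  have hinv : ∀ {s : integralClosure D K}, s ∉ 𝔑 → (algebraMap _ K s)⁻¹ ∈ W := by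
    intro s hs
    have hsu : IsUnit (φ s) := by
      by_contra hnu
      exact hs ((mem_maximalIdeal _).mpr hnu)
    have h1 : ((hsu.unit⁻¹ : Wˣ) : W) * φ s = 1 := hsu.val_inv_mul
    have h2 := congrArg (fun w : W => (w : K)) h1
    simp only [OneMemClass.coe_one] at h2
    have : (algebraMap _ K s)⁻¹ = (((hsu.unit⁻¹ : Wˣ) : W) : K) := (eq_inv_of_mul_eq_one_left h2).symm
    rw [this]
    exact SetLike.coe_mem _
  -- `𝔑 ≠ 0`, otherwise `W = K`
  have h𝔑 : 𝔑 ≠ ⊥ := by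
    intro hbot
    apply hW.1
    refine eq_top_iff.mpr fun x _ => ?_
    obtain ⟨a, b, hb, rfl⟩ := IsFractionRing.div_surjective (A := integralClosure D K) x
    have hb0 : (b : integralClosure D K) ≠ 0 := nonZeroDivisors.ne_zero hb
    have hbN : b ∉ 𝔑 := by rw [hbot, Ideal.mem_bot]; exact hb0
    rw [div_eq_mul_inv]
    exact W.mul_mem _ _ (hbar a) (hinv hbN)
  let v : HeightOneSpectrum (integralClosure D K) := ⟨𝔑, h𝔑p, h𝔑⟩
  refine ⟨v, ValuationSubring.eq_of_le_of_ne_top (v.valuationSubringAtPrime K) (fun x hx => ?_) hW.1⟩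
  obtain ⟨a, s, hs, rfl⟩ := (mem_valuationSubringAtPrime_iff_exists v x).mp hx
  exact W.mul_mem _ _ (hbar a) (hinv hs)

/-- In particular `W ∈ branchValuationSet D ↔ W = D̄_𝔑` for some maximal ideal `𝔑` of `D̄`.
[cite: Kollar2007, §1.4] -/
theorem mem_branchValuationSet_iff_exists {W : ValuationSubring K} :
    W ∈ branchValuationSet D ↔ ∃ v : HeightOneSpectrum (integralClosure D K), v.valuationSubringAtPrime K = W :=
  ⟨exists_valuationSubringAtPrime_eq_of_mem_branchValuationSet, by rintro ⟨v, rfl⟩; exact valuationSubringAtPrime_mem_branchValuationSet v⟩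

/-- A branch is a Noetherian ring (a discrete valuation ring). [cite: Kollar2007, §1.4] -/
theorem isNoetherianRing_of_mem_branchValuationSet {W : ValuationSubring K} (hW : W ∈ branchValuationSet D) :
    IsNoetherianRing W := by
  obtain ⟨v, rfl⟩ := exists_valuationSubringAtPrime_eq_of_mem_branchValuationSet hW
  infer_instance

/-- A branch has Krull dimension `≤ 1`. [cite: Kollar2007, §1.4] -/
theorem krullDimLE_of_mem_branchValuationSet {W : ValuationSubring K} (hW : W ∈ branchValuationSet D) :
    Ring.KrullDimLE 1 W := by
  obtain ⟨v, rfl⟩ := exists_valuationSubringAtPrime_eq_of_mem_branchValuationSet hW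
  infer_instance

/-- **A branch dominates `D`** (for `D` local): a non-unit of `D` is a non-unit of every branch.
[cite: Kollar2007, §1.4] -/
theorem subringDominates_of_mem_branchValuationSet [IsLocalRing D] {W : ValuationSubring K} (hW : W ∈ branchValuationSet D) :
    SubringDominates D W.toSubring := by
  obtain ⟨v, rfl⟩ := exists_valuationSubringAtPrime_eq_of_mem_branchValuationSet hW
  exact subringDominates_valuationSubringAtPrime v

/-- The branches of `D` are finite in number when `D` is Noetherian local with finite
normalization. [cite: Kollar2007, §1.4] -/
theorem branchValuationSet_finite [IsLocalRing D] [IsNoetherianRing D]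
    [Module.Finite D (integralClosure D K)] :
    (branchValuationSet D).Finite := by
  haveI : Finite (HeightOneSpectrum (integralClosure D K)) := finite_heightOneSpectrum D K
  refine (Set.finite_range fun v : HeightOneSpectrum (integralClosure D K) =>
    v.valuationSubringAtPrime K).subset fun W hW => ?_
  obtain ⟨v, rfl⟩ := exists_valuationSubringAtPrime_eq_of_mem_branchValuationSet hW
  exact ⟨v, rfl⟩

omit [IsFractionRing D K] in
/-- `D` has a branch as soon as it is not a field. [cite: Kollar2007, §1.4] -/
theorem branchValuationSet_nonempty (hD : ¬ IsField D) : (branchValuationSet D).Nonempty := by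
  -- `D̄` is not a field, so it has a nonzero maximal ideal
  have hnf : ¬ IsField (integralClosure D K) := by
    intro hF
    haveI : Algebra.IsIntegral D (integralClosure D K) :=
      ⟨fun x => (isIntegral_algHom_iff (integralClosure D K).val Subtype.val_injective).mp x.2⟩
    exact hD ((Algebra.IsIntegral.isField_iff_isField (R := D) (S := integralClosure D K)
      (fun x y h => Subtype.ext (by simpa using congrArg Subtype.val h))).mpr hF)
  obtain ⟨𝔑, h𝔑⟩ := Ideal.exists_maximal (integralClosure D K)
  have h𝔑0 : 𝔑 ≠ ⊥ := Ring.ne_bot_of_isMaximal_of_not_isField h𝔑 hnf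
  exact ⟨_, valuationSubringAtPrime_mem_branchValuationSet (D := D) ⟨𝔑, h𝔑.isPrime, h𝔑0⟩⟩

end Dedekind

end Order

/-! ## Positivity, finiteness, and the drop of the contact order -/

section Drop

variable {D D₁ : Subring K} [IsLocalRing D] [IsDedekindDomain (integralClosure D K)]
  [IsFractionRing (integralClosure D K) K] [IsFractionRing D K]

/-- An element of `𝔪_D` is a non-unit of every branch of `D`. [cite: Kollar2007, §1.4] -/
theorem mem_maximalIdeal_of_mem_branchValuationSet {W : ValuationSubring K} (hW : W ∈ branchValuationSet D)
    {t : D} (ht : t ∈ maximalIdeal D) : (⟨(t : K), hW.2 t.2⟩ : W) ∈ maximalIdeal W := by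
  by_cases h0 : (t : K) = 0
  · have : (⟨(t : K), hW.2 t.2⟩ : W) = 0 := Subtype.ext h0
    rw [this]; exact (maximalIdeal W).zero_mem
  · have hinv : (t : K)⁻¹ ∉ D := fun hmem => ht ((isUnit_subring_iff_inv_mem t).mpr ⟨h0, hmem⟩)
    have hlt := valuation_lt_one_of_subringDominates (subringDominates_of_mem_branchValuationSet hW) t.2 hinv
    exact (W.valuation_lt_one_iff _).mpr hlt

/-- **`contactOrder D J ≥ 1`** when `D` is not a field and `J ⊆ 𝔪_D`: on a branch `W`,
`J W ⊆ 𝔪_W`, so `W/JW ≠ 0`. [cite: Kollar2007, §1.4] -/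
theorem one_le_contactOrder (hD : ¬ IsField D) {J : Set K}
    (hJ : ∀ a ∈ J, ∃ d : D, d ∈ maximalIdeal D ∧ (d : K) = a) : 1 ≤ contactOrder D J := by
  obtain ⟨W, hW⟩ := branchValuationSet_nonempty (D := D) hD
  refine le_trans ?_ (branchLength_le_contactOrder hW J)
  rw [branchLength, Order.one_le_iff_ne_zero, Ne, Module.length_eq_zero_iff,
    not_subsingleton_iff_nontrivial]
  refine Ideal.Quotient.nontrivial_iff.mpr fun htop => (maximalIdeal.isMaximal W).ne_top (top_le_iff.mp ?_)
  rw [← htop]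
  refine Ideal.span_le.mpr fun w hw => ?_
  obtain ⟨d, hd, hdw⟩ := hJ _ hw
  have : w = ⟨(d : K), hW.2 d.2⟩ := Subtype.ext hdw.symm
  rw [this]
  exact mem_maximalIdeal_of_mem_branchValuationSet hW hd

/-- **Finiteness of the contact order** of a subset containing a nonzero element of `D`, for
`D` Noetherian local with finite normalization (each `W/JW`, `W` a discrete valuation ring, has
finite length, and there are finitely many branches). [cite: Kollar2007, §1.4] -/
theorem contactOrder_ne_top [IsNoetherianRing D] [Module.Finite D (integralClosure D K)]
    {J : Set K} (hJ : ∃ a ∈ J, a ∈ D ∧ a ≠ 0) : contactOrder D J ≠ ⊤ := by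
  obtain ⟨a, haJ, haD, ha0⟩ := hJ
  have hfin : ∀ W : branchValuationSet D, branchLength W.1 J ≠ ⊤ := by
    rintro ⟨W, hW⟩
    haveI := isNoetherianRing_of_mem_branchValuationSet hW
    haveI := krullDimLE_of_mem_branchValuationSet hW
    let a' : W := ⟨a, hW.2 haD⟩
    have ha' : a' ∈ nonZeroDivisors W :=
      mem_nonZeroDivisors_of_ne_zero fun e => ha0 (congrArg Subtype.val e)
    have h1 : Module.length W (W ⧸ Ideal.span {a'}) ≠ ⊤ :=
      Module.length_ne_top_iff.mpr (isFiniteLength_quotient_span_singleton _ ha')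
    have hle : Ideal.span {a'} ≤ branchIdeal W J :=
      (Ideal.span_singleton_le_iff_mem _).mpr (mem_branchIdeal haJ)
    have h2 : branchLength W J ≤ Module.length W (W ⧸ Ideal.span {a'}) :=
      Module.length_le_of_surjective (Submodule.factor hle) (Submodule.factor_surjective hle)
    exact fun htop => h1 (top_le_iff.mp (htop ▸ h2))
  haveI : Finite (branchValuationSet D) := (branchValuationSet_finite (D := D)).to_subtype
  let g : branchValuationSet D → ℕ := fun W => (branchLength W.1 J).toNat
  have hg : ∀ W, (g W : ℕ∞) = branchLength W.1 J := fun W => ENat.coe_toNat (hfin W)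
  rw [contactOrder, show (fun W : branchValuationSet D => branchLength W.1 J) = fun W => (g W : ℕ∞) from
    funext fun W => (hg W).symm]
  exact ENat.iSup_coe_ne_top.mpr (Set.finite_range g).bddAbove

/-- **Separation of branches: the contact order drops.** Let `D ⊆ D₁ ⊆ K` (`D` local, not a
field, with Dedekind normalization), `t ∈ 𝔪_D`, and `J, J₁ ⊆ K` with: every element of `J` is
`t` times an element of `J₁ ∩ D₁`, and `J₁ ∩ D₁` contains a nonzero element; suppose moreover
`J ⊆ 𝔪_D`. Then `contactOrder D₁ J₁ + 1 ≤ contactOrder D J`. [cite: Kollar2007, §1.4] -/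
theorem contactOrder_add_one_le (hD : ¬ IsField D) (hDD₁ : D ≤ D₁) {J J₁ : Set K} {t : D}
    (ht : t ∈ maximalIdeal D) (hJ : ∀ a ∈ J, ∃ d : D, d ∈ maximalIdeal D ∧ (d : K) = a)
    (h : ∀ a ∈ J, ∃ y ∈ D₁, y ∈ J₁ ∧ a = (t : K) * y)
    (h₁ : ∃ z ∈ J₁, z ∈ D₁ ∧ z ≠ 0) : contactOrder D₁ J₁ + 1 ≤ contactOrder D J := by
  by_cases hne : (branchValuationSet D₁).Nonempty
  · haveI : Nonempty (branchValuationSet D₁) := hne.to_subtype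
    rw [contactOrder, ENat.iSup_add]
    refine iSup_le fun W => ?_
    have hWD : W.1 ∈ branchValuationSet D := branchValuationSet_mono hDD₁ W.2
    haveI := isNoetherianRing_of_mem_branchValuationSet hWD
    let t' : W.1 := ⟨(t : K), hWD.2 t.2⟩
    have ht' : t' ∈ maximalIdeal W.1 := mem_maximalIdeal_of_mem_branchValuationSet hWD ht
    have h' : ∀ a ∈ J, ∃ y : W.1, (y : K) ∈ J₁ ∧ a = (t' : K) * y := by
      intro a ha
      obtain ⟨y, hy₁, hyJ, hay⟩ := h a ha
      exact ⟨⟨y, W.2.2 hy₁⟩, hyJ, hay⟩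
    obtain ⟨z, hzJ, hz₁, hz0⟩ := h₁
    have h₁' : branchIdeal W.1 J₁ ≠ ⊥ :=
      branchIdeal_ne_bot (w := ⟨z, W.2.2 hz₁⟩) hzJ fun e => hz0 (congrArg Subtype.val e)
    exact (branchLength_add_one_le t' ht' h' h₁').trans (branchLength_le_contactOrder hWD J)
  · have hempty : IsEmpty (branchValuationSet D₁) := by
      rw [Set.not_nonempty_iff_eq_empty] at hne
      exact Set.isEmpty_coe_sort.mpr hne
    rw [contactOrder, iSup_of_empty, bot_eq_zero, zero_add]
    exact one_le_contactOrder hD hJ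

end Drop

end Literature.AlgebraicGeometry.Resolution
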